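import Summits.QuantumFields.BalabanUV.Beta.FP.RelInvPeriodisedMinOpRecord

/-!
# `BalabanUV.Beta.FP.CoarseJetOrderOne` — road «FP» (binder row D1), ROUTE T, the (T-INV) ∕ (T-ID) junction at ORDER 1:
# THE COARSE FIRST JET OF THE TORUS CALL IN CLOSED FORM — the `μμ` block of the effective-form jet word `(L·H₁ − S·B)·I − L·Bᵀ·S`
# is the `Â`-SANDWICH of the level-`j` first insertion tables; the dictionary's `hId₁` becomes ONE explicit identity between periodised kernels

HONEST DEPENDENCY (page 1, mandatory): continuum YM on T⁴ ⇐ BetaPertH ∧ nine spine estimates (0/9 proved); BetaPertH ⇐ (D1) ∧ (D4) ∧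
CAP+tail; G-an2-4 gates asym, D1 and NE2/3/4.  HONEST FRAMING (cell contract, verbatim): «discharging `BetaPertH` makes Bałaban's UV
stability UNCONDITIONAL — a real constructive-QFT result; it is NOT the continuum limit and NOT the Clay problem.»  ABSOLUTE RULE (cell
charter, verbatim): «No internally-minted statement may enter as a cited fact. Every hypothesis is either kernel-proved in this package or a
verbatim quotation of a PUBLISHED theorem with page reference. The manuscript(s) under audit are NOT citable for their own disputed steps — they
are the thing under adjudication; programme-internal (2001/route/tribunal) claims are never citable.»  THIS MODULE is [folklore] finite-dimensional
bookkeeping BY NAME over `RelInvPeriodisedEffForm.effForm_toBlocks₁₁_eq_perF_KInvStep` (p314950, the `μμ` block `S₁₁ = Â∘(fμ,fμ)`) and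
`RelInvPeriodisedMinOpRecord.torus_minOp_submatrix_inl ∕ torus_minOpL_submatrix_inl` (the mixed blocks `±axEc·Â`).  No `Prop`, no `def`, nothing cited,
0 sorry.  «not in print; our bookkeeping».

WHY.  In `NestedStepLawOneShotJets.secondVar_oneShot_nestedStepLaw_jets` (p308750) ∕ the torus call (p313662, `…Delta` p316503) the COARSE first jet is
`((L·H₁ − S·B)·I − L·Bᵀ·S).toBlocks₁₁` (`I = minOp`, `L = minOpL`, `S = effForm` of the fine sliced level-`j` system, `B = [Q₁₁;0]`; the (J-E′) word `𝔊̇` of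
`EffectiveFormJetsMovingBorder`).  The dictionary (Q-FP-16-5 order 1, an2) must identify it with `(wVH d Lc (j+1))⁻¹ •` the level-`(j+1)` first insertion
table (`CoarseJetUnit`'s `hId₁`).  Its `μμ` block sees only the `μ`-columns of `I`, the `μ`-rows of `L` and `S₁₁` (§1, pure algebra), and those three
blocks are KNOWN on the torus (p314950 (E) + `RelInvPeriodisedMinOpRecord`): so `hId₁` is the explicit SANDWICH IDENTITY of §2 — the level-`(j+1)` first
insertion table is the `Â`-conjugate of the level-`j` first insertion tables (form AND averaging), `Â := perF M (coDressKBmAt (toSite r) Lc (KInvStep Lc j))`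
masked to the non-comb field slots by an2's `axEc` — the background-field chain rule `Ṡ = (K̃⁻¹·K̃̇·K̃⁻¹)₂₂` read on the torus blocks of record.

CONTENT.
* §1 `orderOne_word_toBlocks₁₁` (generic, any field): `((L·H₁ − S·B)·I − L·Bᵀ·S)₁₁ = L_{μ·}·H₁·I_{·μ} − S₁₁·Q₁₁·I_{·μ} − L_{μ·}·Q₁₁ᵀ·S₁₁` for `B = [Q₁₁;0]`
  (`I_{·μ} := I.submatrix id inl`, `L_{μ·} := L.submatrix inl id`).
* §2 **`torus_orderOne_word_toBlocks₁₁`** — at the presentation of record on ANY box `M` with `Lc ∣ Mᵢ` (fields `(s,α) ↦ (s, inl α)`, `τ₁ := combRowsT`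
  on the field slots, coarse multipliers by any injective `inr`-valued `fμ` with `hcoarse`; namings `hI hL hS hB` as in p308750): with
  `Θ := of (fun (s,α) a ↦ axEc s s (inl α) (inl α) · Â (s, inl α) (fμ a))`, `Θᴸ := of (fun a (s,α) ↦ axEc s s (inl α) (inl α) · Â (fμ a) (s, inl α))`,
  `Ŝ := (perF M (KInvStep Lc j))∘(fμ,fμ)`:
  `((L·H₁ − S·B)·I − L·Bᵀ·S).toBlocks₁₁ = −(Θᴸ·H₁·Θ) − Ŝ·Q₁₁·Θ + Θᴸ·Q₁₁ᵀ·Ŝ` for ANY first jets `H₁ Q₁₁`;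
  **`torus_hId₁_iff`** — hence the dictionary's `hId₁ : ((L·H₁ − S·B)·I − L·Bᵀ·S).toBlocks₁₁ = c • H'₁` is EQUIVALENT to the sandwich identity
  `−(Θᴸ·H₁·Θ) − Ŝ·Q₁₁·Θ + Θᴸ·Q₁₁ᵀ·Ŝ = c • H'₁`;
  `orderOne_word_toBlocks₁₁_symm` ∕ **`torus_orderOne_word_toBlocks₁₁_symm`** — with the fine form symmetric (`H₀ᵀ = H₀`, displayed; `L = Iᵀ`, `S₁₁ᵀ = S₁₁`)
  the coarse first jet is `Θᵀ·H₁·Θ − (Ŝ·Q₁₁·Θ + (Ŝ·Q₁₁·Θ)ᵀ)` (manifestly symmetric for symmetric `H₁`).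
WHAT IT IS NOT: NOT a proof of `hId₁` (the sandwich identity between an1's level-`j` and level-`(j+1)` first insertion tables is the dictionary's, an2's
Q-FP-16-5 order 1 — `SrecOf_succ`'s cubic slot); NOT order 2; NOT (T-ID), NOT SDF, NOT D1, NOT BetaPertH, NOT continuum, NOT Clay; discharges NO binder
of row D1 by itself; 0 estimates.  Unit `b2b-balaban-beta-d1-formalise-leaf-05` (gen 26), 2026-08-22.
-/

noncomputable section

open scoped BigOperators Matrix

namespace Summit.QuantumFields.BalabanUV.Beta.FP.CoarseJetOrderOne

open Matrix
open Literature.Probability.LatticeModels (Torus.proj)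
open Literature.MathematicalPhysics.QuantumFieldTheory.Balaban1983to89
open Literature.MathematicalPhysics.QuantumFieldTheory.Balaban1983to89.Beta
open Literature.MathematicalPhysics.QuantumFieldTheory.Balaban1983to89.Beta.Composition (kkt)
open Literature.MathematicalPhysics.QuantumFieldTheory.Balaban1983to89.Beta.CompositionSingular (effForm minOp minOpL minOpL_eq_transpose)
open B6Lemma24Torus (pbox)
open AffineAveraging (Site box toSite)
open OneStepResolventKernel (Fib)
open OneStepKernelFamily (KInvStep)
open Summit.QuantumFields.BalabanUV.Beta.AxialDressingRooted (coDressKBmAt axEc)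
open Summit.QuantumFields.BalabanUV.Beta.BorderedHessian (bhKStepAt)
open Summit.QuantumFields.BalabanUV.Beta.FP.KernelPeriodisationFib (Idx perF)
open Summit.QuantumFields.BalabanUV.Beta.FP.TorusCombRows (Res combRowsT)
open Summit.QuantumFields.BalabanUV.Beta.FP.RelInvPeriodisedEffForm (effForm_toBlocks₁₁_eq_perF_KInvStep)
open Summit.QuantumFields.BalabanUV.Beta.FP.RelInvPeriodisedMinOpRecord (torus_minOp_submatrix_inl torus_minOpL_submatrix_inl)

/-! ## §1 Generic: the `μμ` block of the order-1 effective-form word sees only three blocks -/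

section Generic

variable {𝕜 : Type*} [Field 𝕜]
variable {ν μ ρ₁ : Type*} [Fintype ν] [Fintype μ] [Fintype ρ₁]

/-- [folklore] **THE `μμ` BLOCK OF THE ORDER-1 WORD**: for `B = [Q₁₁; 0]`,
`((L·H₁ − S·B)·I − L·Bᵀ·S).toBlocks₁₁ = L_{μ·}·H₁·I_{·μ} − S₁₁·Q₁₁·I_{·μ} − L_{μ·}·Q₁₁ᵀ·S₁₁` — the slice-multiplier rows ∕ columns never enter. -/
theorem orderOne_word_toBlocks₁₁ (H₁ : Matrix ν ν 𝕜) (Q₁₁ : Matrix μ ν 𝕜)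
    (I : Matrix ν (μ ⊕ ρ₁) 𝕜) (L : Matrix (μ ⊕ ρ₁) ν 𝕜) (S : Matrix (μ ⊕ ρ₁) (μ ⊕ ρ₁) 𝕜) {B : Matrix (μ ⊕ ρ₁) ν 𝕜}
    (hB : fromRows Q₁₁ (0 : Matrix ρ₁ ν 𝕜) = B) :
    ((L * H₁ - S * B) * I - L * Bᵀ * S).toBlocks₁₁
      = L.submatrix Sum.inl id * H₁ * I.submatrix id Sum.inl
        - S.toBlocks₁₁ * Q₁₁ * I.submatrix id Sum.inl - L.submatrix Sum.inl id * Q₁₁ᵀ * S.toBlocks₁₁ := by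
  subst hB
  ext a a'
  simp only [Matrix.toBlocks₁₁, of_apply, Matrix.sub_apply, Matrix.mul_apply, submatrix_apply, id_eq, transpose_apply,
    Fintype.sum_sum_type, fromRows_apply_inl, fromRows_apply_inr, Matrix.zero_apply, mul_zero, zero_mul, add_zero,
    Finset.sum_const_zero, sub_mul, Finset.sum_sub_distrib]

/-- [folklore] **SYMMETRIC FORM**: if the fine form is symmetric (`H₀ᵀ = H₀`, so `L = Iᵀ` and `S₁₁ᵀ = S₁₁` by `CompositionSingular.minOpL_eq_transpose`),
the `μμ` block of the order-1 word is MANIFESTLY SYMMETRIC for symmetric `H₁`: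
`((L·H₁ − S·B)·I − L·Bᵀ·S)₁₁ = I_{·μ}ᵀ·H₁·I_{·μ} − (S₁₁·Q₁₁·I_{·μ} + (S₁₁·Q₁₁·I_{·μ})ᵀ)`. -/
theorem orderOne_word_toBlocks₁₁_symm [DecidableEq ν] [DecidableEq μ] [DecidableEq ρ₁]
    (H₀ : Matrix ν ν 𝕜) (Q₁₀ : Matrix μ ν 𝕜) (τ₁ : Matrix ρ₁ ν 𝕜) (hH₀t : H₀ᵀ = H₀) (H₁ : Matrix ν ν 𝕜) (Q₁₁ : Matrix μ ν 𝕜)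
    {I : Matrix ν (μ ⊕ ρ₁) 𝕜} {L : Matrix (μ ⊕ ρ₁) ν 𝕜} {S : Matrix (μ ⊕ ρ₁) (μ ⊕ ρ₁) 𝕜} {B : Matrix (μ ⊕ ρ₁) ν 𝕜}
    (hI : minOp H₀ (fromRows Q₁₀ τ₁) = I) (hL : minOpL H₀ (fromRows Q₁₀ τ₁) = L) (hS : effForm H₀ (fromRows Q₁₀ τ₁) = S)
    (hB : fromRows Q₁₁ (0 : Matrix ρ₁ ν 𝕜) = B) :
    ((L * H₁ - S * B) * I - L * Bᵀ * S).toBlocks₁₁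
      = (I.submatrix id Sum.inl)ᵀ * H₁ * I.submatrix id Sum.inl
        - (S.toBlocks₁₁ * Q₁₁ * I.submatrix id Sum.inl + (S.toBlocks₁₁ * Q₁₁ * I.submatrix id Sum.inl)ᵀ) := by
  obtain ⟨hLt, -, hSt⟩ := minOpL_eq_transpose H₀ (fromRows Q₁₀ τ₁) hH₀t
  rw [hI, hL] at hLt
  rw [hS] at hSt
  have hLsub : L.submatrix Sum.inl id = (I.submatrix id Sum.inl)ᵀ := by
    rw [hLt]; ext a b; rfl
  have hS11 : (S.toBlocks₁₁)ᵀ = S.toBlocks₁₁ := by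
    ext a a'
    simp only [Matrix.toBlocks₁₁, transpose_apply, of_apply]
    exact congrFun (congrFun hSt (Sum.inl a)) (Sum.inl a')
  rw [orderOne_word_toBlocks₁₁ H₁ Q₁₁ I L S hB, hLsub, Matrix.transpose_mul, Matrix.transpose_mul, hS11, ← Matrix.mul_assoc]
  abel

end Generic

/-! ## §2 At the record: the coarse first jet is the `Â`-sandwich of the level-`j` first insertion tables -/

section Record

variable {d : ℕ} {Lc : ℕ} [NeZero Lc] {r : Fin (d + 1) → ℕ} (M : Fin (d + 1) → ℕ) [∀ μ, NeZero (M μ)]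

set_option synthInstance.maxSize 1024 in
/-- **[folklore] THE COARSE FIRST JET OF THE TORUS CALL IN CLOSED FORM.**  On any box `M` with `Lc ∣ Mᵢ`, root `r ∈ box (d+1) Lc`, at the
presentation of record (`H₀ Q₁₀ τ₁` by the defining equations of p313662 with coarse multipliers presented by any injective `inr`-valued `fμ`
with `hcoarse`; namings `hI hL hS` of the minimiser, its left companion and the effective form, `hB : [Q₁₁;0] = B`), for ANY first jets
`H₁ : Matrix ν ν ℝ`, `Q₁₁ : Matrix μ ν ℝ`:
`((L·H₁ − S·B)·I − L·Bᵀ·S).toBlocks₁₁ = −(Θᴸ·H₁·Θ) − Ŝ·Q₁₁·Θ + Θᴸ·Q₁₁ᵀ·Ŝ`, where `Θ (s,α) a := axEc s s (inl α) (inl α) · Â (s, inl α) (fμ a)`,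
`Θᴸ a (s,α) := axEc s s (inl α) (inl α) · Â (fμ a) (s, inl α)`, `Ŝ := (perF M (KInvStep Lc j))∘(fμ,fμ)`, `Â := perF M (coDressKBmAt (toSite r) Lc (KInvStep Lc j))`. -/
theorem torus_orderOne_word_toBlocks₁₁ (hr : r ∈ box (d + 1) Lc) (hM : ∀ i, Lc ∣ M i) (j : ℕ)
    {μ : Type*} [Fintype μ] [DecidableEq μ] (fμ : μ → Idx M (Fib d)) (hfμ : Function.Injective fμ)
    (hμ : ∀ a : μ, ∃ m : Fin (d + 1), (fμ a).2 = Sum.inr m)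
    (hcoarse : ∀ (s : ↥(pbox M)) (m : Fin (d + 1)), ((s, Sum.inr m) : Idx M (Fib d)) ∈ Set.range fμ ↔ Torus.proj Lc (s : Site (d + 1)) = 0)
    -- the fine sliced system of record, by defining equations
    {H₀ : Matrix (↥(pbox M) × Fin (d + 1)) (↥(pbox M) × Fin (d + 1)) ℝ} {Q₁₀ : Matrix μ (↥(pbox M) × Fin (d + 1)) ℝ}
    {τ₁ : Matrix (Res (toSite r) Lc M) (↥(pbox M) × Fin (d + 1)) ℝ}
    (hH₀ : H₀ = (perF M (bhKStepAt d (toSite r) Lc j)).submatrix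
        (fun b : ↥(pbox M) × Fin (d + 1) => ((b.1, Sum.inl b.2) : Idx M (Fib d))) (fun b : ↥(pbox M) × Fin (d + 1) => ((b.1, Sum.inl b.2) : Idx M (Fib d))))
    (hQ₁₀ : Q₁₀ = (perF M (bhKStepAt d (toSite r) Lc j)).submatrix fμ (fun b : ↥(pbox M) × Fin (d + 1) => ((b.1, Sum.inl b.2) : Idx M (Fib d))))
    (hτ₁ : τ₁ = (combRowsT (toSite r) Lc M).submatrix id (fun b : ↥(pbox M) × Fin (d + 1) => ((b.1, Sum.inl b.2) : Idx M (Fib d))))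
    -- the blocks of its inverse and the sliced border jet, NAMED (p308750's `hI hL hS hB`)
    {I : Matrix (↥(pbox M) × Fin (d + 1)) (μ ⊕ Res (toSite r) Lc M) ℝ} {L : Matrix (μ ⊕ Res (toSite r) Lc M) (↥(pbox M) × Fin (d + 1)) ℝ}
    {S : Matrix (μ ⊕ Res (toSite r) Lc M) (μ ⊕ Res (toSite r) Lc M) ℝ} {B : Matrix (μ ⊕ Res (toSite r) Lc M) (↥(pbox M) × Fin (d + 1)) ℝ}
    (hI : minOp H₀ (fromRows Q₁₀ τ₁) = I) (hL : minOpL H₀ (fromRows Q₁₀ τ₁) = L) (hS : effForm H₀ (fromRows Q₁₀ τ₁) = S)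
    (H₁ : Matrix (↥(pbox M) × Fin (d + 1)) (↥(pbox M) × Fin (d + 1)) ℝ) (Q₁₁ : Matrix μ (↥(pbox M) × Fin (d + 1)) ℝ)
    (hB : fromRows Q₁₁ (0 : Matrix (Res (toSite r) Lc M) (↥(pbox M) × Fin (d + 1)) ℝ) = B) :
    ((L * H₁ - S * B) * I - L * Bᵀ * S).toBlocks₁₁
      = -((Matrix.of fun (a : μ) (b : ↥(pbox M) × Fin (d + 1)) =>
              axEc (toSite r) Lc (b.1 : Site (d + 1)) (b.1 : Site (d + 1)) (Sum.inl b.2) (Sum.inl b.2)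
                * perF M (coDressKBmAt (toSite r) Lc (KInvStep (d := d) Lc j)) (fμ a) (b.1, Sum.inl b.2))
            * H₁
            * (Matrix.of fun (b : ↥(pbox M) × Fin (d + 1)) (a : μ) =>
                axEc (toSite r) Lc (b.1 : Site (d + 1)) (b.1 : Site (d + 1)) (Sum.inl b.2) (Sum.inl b.2)
                  * perF M (coDressKBmAt (toSite r) Lc (KInvStep (d := d) Lc j)) (b.1, Sum.inl b.2) (fμ a)))
        - (perF M (KInvStep (d := d) Lc j)).submatrix fμ fμ * Q₁₁
            * (Matrix.of fun (b : ↥(pbox M) × Fin (d + 1)) (a : μ) =>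
                axEc (toSite r) Lc (b.1 : Site (d + 1)) (b.1 : Site (d + 1)) (Sum.inl b.2) (Sum.inl b.2)
                  * perF M (coDressKBmAt (toSite r) Lc (KInvStep (d := d) Lc j)) (b.1, Sum.inl b.2) (fμ a))
        + (Matrix.of fun (a : μ) (b : ↥(pbox M) × Fin (d + 1)) =>
              axEc (toSite r) Lc (b.1 : Site (d + 1)) (b.1 : Site (d + 1)) (Sum.inl b.2) (Sum.inl b.2)
                * perF M (coDressKBmAt (toSite r) Lc (KInvStep (d := d) Lc j)) (fμ a) (b.1, Sum.inl b.2))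
            * Q₁₁ᵀ * (perF M (KInvStep (d := d) Lc j)).submatrix fμ fμ := by
  rw [orderOne_word_toBlocks₁₁ H₁ Q₁₁ I L S hB, ← hI, ← hL, ← hS, hH₀, hQ₁₀, hτ₁,
    torus_minOp_submatrix_inl M hr hM j fμ hfμ hμ hcoarse, torus_minOpL_submatrix_inl M hr hM j fμ hfμ hμ hcoarse,
    effForm_toBlocks₁₁_eq_perF_KInvStep M hr hM j fμ hfμ hμ hcoarse]
  simp only [Matrix.neg_mul, sub_neg_eq_add]

set_option synthInstance.maxSize 1024 in
/-- **[folklore] THE DICTIONARY's `hId₁` IS THE SANDWICH IDENTITY.**  In the setting of `torus_orderOne_word_toBlocks₁₁`, for any scalar `c` and any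
candidate level-`(j+1)` first insertion table `H'₁`:
`((L·H₁ − S·B)·I − L·Bᵀ·S).toBlocks₁₁ = c • H'₁ ↔ −(Θᴸ·H₁·Θ) − Ŝ·Q₁₁·Θ + Θᴸ·Q₁₁ᵀ·Ŝ = c • H'₁`. -/
theorem torus_hId₁_iff (hr : r ∈ box (d + 1) Lc) (hM : ∀ i, Lc ∣ M i) (j : ℕ)
    {μ : Type*} [Fintype μ] [DecidableEq μ] (fμ : μ → Idx M (Fib d)) (hfμ : Function.Injective fμ)
    (hμ : ∀ a : μ, ∃ m : Fin (d + 1), (fμ a).2 = Sum.inr m)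
    (hcoarse : ∀ (s : ↥(pbox M)) (m : Fin (d + 1)), ((s, Sum.inr m) : Idx M (Fib d)) ∈ Set.range fμ ↔ Torus.proj Lc (s : Site (d + 1)) = 0)
    {H₀ : Matrix (↥(pbox M) × Fin (d + 1)) (↥(pbox M) × Fin (d + 1)) ℝ} {Q₁₀ : Matrix μ (↥(pbox M) × Fin (d + 1)) ℝ}
    {τ₁ : Matrix (Res (toSite r) Lc M) (↥(pbox M) × Fin (d + 1)) ℝ}
    (hH₀ : H₀ = (perF M (bhKStepAt d (toSite r) Lc j)).submatrix
        (fun b : ↥(pbox M) × Fin (d + 1) => ((b.1, Sum.inl b.2) : Idx M (Fib d))) (fun b : ↥(pbox M) × Fin (d + 1) => ((b.1, Sum.inl b.2) : Idx M (Fib d))))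
    (hQ₁₀ : Q₁₀ = (perF M (bhKStepAt d (toSite r) Lc j)).submatrix fμ (fun b : ↥(pbox M) × Fin (d + 1) => ((b.1, Sum.inl b.2) : Idx M (Fib d))))
    (hτ₁ : τ₁ = (combRowsT (toSite r) Lc M).submatrix id (fun b : ↥(pbox M) × Fin (d + 1) => ((b.1, Sum.inl b.2) : Idx M (Fib d))))
    {I : Matrix (↥(pbox M) × Fin (d + 1)) (μ ⊕ Res (toSite r) Lc M) ℝ} {L : Matrix (μ ⊕ Res (toSite r) Lc M) (↥(pbox M) × Fin (d + 1)) ℝ}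
    {S : Matrix (μ ⊕ Res (toSite r) Lc M) (μ ⊕ Res (toSite r) Lc M) ℝ} {B : Matrix (μ ⊕ Res (toSite r) Lc M) (↥(pbox M) × Fin (d + 1)) ℝ}
    (hI : minOp H₀ (fromRows Q₁₀ τ₁) = I) (hL : minOpL H₀ (fromRows Q₁₀ τ₁) = L) (hS : effForm H₀ (fromRows Q₁₀ τ₁) = S)
    (H₁ : Matrix (↥(pbox M) × Fin (d + 1)) (↥(pbox M) × Fin (d + 1)) ℝ) (Q₁₁ : Matrix μ (↥(pbox M) × Fin (d + 1)) ℝ)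
    (hB : fromRows Q₁₁ (0 : Matrix (Res (toSite r) Lc M) (↥(pbox M) × Fin (d + 1)) ℝ) = B)
    (c : ℝ) (H'₁ : Matrix μ μ ℝ) :
    ((L * H₁ - S * B) * I - L * Bᵀ * S).toBlocks₁₁ = c • H'₁ ↔
      -((Matrix.of fun (a : μ) (b : ↥(pbox M) × Fin (d + 1)) =>
              axEc (toSite r) Lc (b.1 : Site (d + 1)) (b.1 : Site (d + 1)) (Sum.inl b.2) (Sum.inl b.2)
                * perF M (coDressKBmAt (toSite r) Lc (KInvStep (d := d) Lc j)) (fμ a) (b.1, Sum.inl b.2))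
            * H₁
            * (Matrix.of fun (b : ↥(pbox M) × Fin (d + 1)) (a : μ) =>
                axEc (toSite r) Lc (b.1 : Site (d + 1)) (b.1 : Site (d + 1)) (Sum.inl b.2) (Sum.inl b.2)
                  * perF M (coDressKBmAt (toSite r) Lc (KInvStep (d := d) Lc j)) (b.1, Sum.inl b.2) (fμ a)))
        - (perF M (KInvStep (d := d) Lc j)).submatrix fμ fμ * Q₁₁
            * (Matrix.of fun (b : ↥(pbox M) × Fin (d + 1)) (a : μ) =>
                axEc (toSite r) Lc (b.1 : Site (d + 1)) (b.1 : Site (d + 1)) (Sum.inl b.2) (Sum.inl b.2)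
                  * perF M (coDressKBmAt (toSite r) Lc (KInvStep (d := d) Lc j)) (b.1, Sum.inl b.2) (fμ a))
        + (Matrix.of fun (a : μ) (b : ↥(pbox M) × Fin (d + 1)) =>
              axEc (toSite r) Lc (b.1 : Site (d + 1)) (b.1 : Site (d + 1)) (Sum.inl b.2) (Sum.inl b.2)
                * perF M (coDressKBmAt (toSite r) Lc (KInvStep (d := d) Lc j)) (fμ a) (b.1, Sum.inl b.2))
            * Q₁₁ᵀ * (perF M (KInvStep (d := d) Lc j)).submatrix fμ fμ
        = c • H'₁ := by
  rw [torus_orderOne_word_toBlocks₁₁ M hr hM j fμ hfμ hμ hcoarse hH₀ hQ₁₀ hτ₁ hI hL hS H₁ Q₁₁ hB]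

set_option synthInstance.maxSize 1024 in
/-- **[folklore] SYMMETRIC FORM AT THE RECORD**: with the fine form symmetric (`hH₀t : H₀ᵀ = H₀`, displayed — leaf-02's `PeriodisedWardOrderZero.torus_H₀_transpose`
discharges it), the coarse first jet is `Θᵀ·H₁·Θ − (Ŝ·Q₁₁·Θ + (Ŝ·Q₁₁·Θ)ᵀ)` — so an2's `hId₁` reads
`(wVH (j+1))⁻¹ • H'₁ = Θᵀ·H₁·Θ − (Ŝ·Q₁₁·Θ + (Ŝ·Q₁₁·Θ)ᵀ)`: the level-`(j+1)` first insertion table is the `Θ`-pullback of the level-`j` first form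
insertion minus the symmetrised `Ŝ·Q₁₁·Θ` (averaging insertion read through the effective form and the minimiser). -/
theorem torus_orderOne_word_toBlocks₁₁_symm (hr : r ∈ box (d + 1) Lc) (hM : ∀ i, Lc ∣ M i) (j : ℕ)
    {μ : Type*} [Fintype μ] [DecidableEq μ] (fμ : μ → Idx M (Fib d)) (hfμ : Function.Injective fμ)
    (hμ : ∀ a : μ, ∃ m : Fin (d + 1), (fμ a).2 = Sum.inr m)
    (hcoarse : ∀ (s : ↥(pbox M)) (m : Fin (d + 1)), ((s, Sum.inr m) : Idx M (Fib d)) ∈ Set.range fμ ↔ Torus.proj Lc (s : Site (d + 1)) = 0)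
    {H₀ : Matrix (↥(pbox M) × Fin (d + 1)) (↥(pbox M) × Fin (d + 1)) ℝ} {Q₁₀ : Matrix μ (↥(pbox M) × Fin (d + 1)) ℝ}
    {τ₁ : Matrix (Res (toSite r) Lc M) (↥(pbox M) × Fin (d + 1)) ℝ}
    (hH₀ : H₀ = (perF M (bhKStepAt d (toSite r) Lc j)).submatrix
        (fun b : ↥(pbox M) × Fin (d + 1) => ((b.1, Sum.inl b.2) : Idx M (Fib d))) (fun b : ↥(pbox M) × Fin (d + 1) => ((b.1, Sum.inl b.2) : Idx M (Fib d))))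
    (hQ₁₀ : Q₁₀ = (perF M (bhKStepAt d (toSite r) Lc j)).submatrix fμ (fun b : ↥(pbox M) × Fin (d + 1) => ((b.1, Sum.inl b.2) : Idx M (Fib d))))
    (hτ₁ : τ₁ = (combRowsT (toSite r) Lc M).submatrix id (fun b : ↥(pbox M) × Fin (d + 1) => ((b.1, Sum.inl b.2) : Idx M (Fib d))))
    (hH₀t : H₀ᵀ = H₀)
    {I : Matrix (↥(pbox M) × Fin (d + 1)) (μ ⊕ Res (toSite r) Lc M) ℝ} {L : Matrix (μ ⊕ Res (toSite r) Lc M) (↥(pbox M) × Fin (d + 1)) ℝ}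
    {S : Matrix (μ ⊕ Res (toSite r) Lc M) (μ ⊕ Res (toSite r) Lc M) ℝ} {B : Matrix (μ ⊕ Res (toSite r) Lc M) (↥(pbox M) × Fin (d + 1)) ℝ}
    (hI : minOp H₀ (fromRows Q₁₀ τ₁) = I) (hL : minOpL H₀ (fromRows Q₁₀ τ₁) = L) (hS : effForm H₀ (fromRows Q₁₀ τ₁) = S)
    (H₁ : Matrix (↥(pbox M) × Fin (d + 1)) (↥(pbox M) × Fin (d + 1)) ℝ) (Q₁₁ : Matrix μ (↥(pbox M) × Fin (d + 1)) ℝ)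
    (hB : fromRows Q₁₁ (0 : Matrix (Res (toSite r) Lc M) (↥(pbox M) × Fin (d + 1)) ℝ) = B) :
    ((L * H₁ - S * B) * I - L * Bᵀ * S).toBlocks₁₁
      = (Matrix.of fun (b : ↥(pbox M) × Fin (d + 1)) (a : μ) =>
            axEc (toSite r) Lc (b.1 : Site (d + 1)) (b.1 : Site (d + 1)) (Sum.inl b.2) (Sum.inl b.2)
              * perF M (coDressKBmAt (toSite r) Lc (KInvStep (d := d) Lc j)) (b.1, Sum.inl b.2) (fμ a))ᵀ
          * H₁
          * (Matrix.of fun (b : ↥(pbox M) × Fin (d + 1)) (a : μ) =>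
              axEc (toSite r) Lc (b.1 : Site (d + 1)) (b.1 : Site (d + 1)) (Sum.inl b.2) (Sum.inl b.2)
                * perF M (coDressKBmAt (toSite r) Lc (KInvStep (d := d) Lc j)) (b.1, Sum.inl b.2) (fμ a))
        - ((perF M (KInvStep (d := d) Lc j)).submatrix fμ fμ * Q₁₁
              * (Matrix.of fun (b : ↥(pbox M) × Fin (d + 1)) (a : μ) =>
                  axEc (toSite r) Lc (b.1 : Site (d + 1)) (b.1 : Site (d + 1)) (Sum.inl b.2) (Sum.inl b.2)
                    * perF M (coDressKBmAt (toSite r) Lc (KInvStep (d := d) Lc j)) (b.1, Sum.inl b.2) (fμ a))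
            + ((perF M (KInvStep (d := d) Lc j)).submatrix fμ fμ * Q₁₁
                * (Matrix.of fun (b : ↥(pbox M) × Fin (d + 1)) (a : μ) =>
                    axEc (toSite r) Lc (b.1 : Site (d + 1)) (b.1 : Site (d + 1)) (Sum.inl b.2) (Sum.inl b.2)
                      * perF M (coDressKBmAt (toSite r) Lc (KInvStep (d := d) Lc j)) (b.1, Sum.inl b.2) (fμ a)))ᵀ) := by
  rw [orderOne_word_toBlocks₁₁_symm H₀ Q₁₀ τ₁ hH₀t H₁ Q₁₁ hI hL hS hB, ← hI, ← hS, hH₀, hQ₁₀, hτ₁,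
    torus_minOp_submatrix_inl M hr hM j fμ hfμ hμ hcoarse, effForm_toBlocks₁₁_eq_perF_KInvStep M hr hM j fμ hfμ hμ hcoarse]

end Record

end Summit.QuantumFields.BalabanUV.Beta.FP.CoarseJetOrderOne

end
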